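import Summits.ValiantsHypothesis.ValiantsHypothesis.Theorems.LacunarySymmetroidMatrixDescartesFiniteSectorIterMasksWalk
import Summits.ValiantsHypothesis.ValiantsHypothesis.Theorems.LacunarySymmetroidMatrixDescartesFiniteSector

/-!
# `MatrixDescartes` — line «stamp»: the STAMP CEILING `ν(56,4) ≤ 10910 = n(56,3)` (kernel) — `StampLawAt 56 4 10910`

HONEST FRAMING.  Object-search cell `pub-symmetroid`, seat val-sym-door-p5 g12.  HELPER of the crux item `stmt-ValiantsHypothesis-18050` (`Theses.LacunarySymmetroid.MatrixDescartes`)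
with NO closure claim.  T3 (`mem_sumset_of_fullPos`) makes every `r ≤ deg` of a full-positive-rooted symmetric `56 × 56` half-pencil with `4` terms an
`56`-fold sum of exponents; the values `0, 1` occur, and the capped, padded, sorted value set must cover `[0, deg]`; the finite core — no `3` denominations
with `56` stamps cover `[0, 10911]` (`n(56,3) = 10910`) — has 32 452 live prefixes and is decided in the kernel in the WALKER shape of
`…FiniteSectorIterMasksWalk` (seat val-sym-door-p5 g12; slices `stampWalk_fiftysix_four_s1_*` in this file); the transfer reads the census sum
set as capped multisets and peels the walker level by level (`walk_true`).  Result: `stampLawAt_fiftysix_four : StampLawAt 56 4 10910`.  Located first (exact DFS, 0 violations of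
Conjecture Σ): best reach of `3` denominations with `56` stamps = `10910` (e.g. `{1,41,547}`).  Nothing here bears on the crux (asymptotic), on the doors, or on `VP ≠ VNP`.
[folklore] Postage-stamp bookkeeping on the proved T3 (Guy UPINT C12; Challis / Mossige tables); no citation is load-bearing.
-/

-- `Summit.ValiantsHypothesis.ValiantsHypothesis.…` repeats a component by the D-0017 layout
-- (single-conjunct summit), which the `dupNamespace` linter flags; the name is mandated.
set_option linter.dupNamespace false

namespace Summit.ValiantsHypothesis.ValiantsHypothesis.Theorems.LacunarySymmetroidMatrixDescartes.FiniteSector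

open scoped BigOperators Matrix
open Polynomial

/-! ## `(56,4)`: `ν(56,4) ≤ n(56,3) = 10910` -/

set_option synthInstance.maxSize 2000000 in
set_option synthInstance.maxHeartbeats 2000000 in
set_option maxHeartbeats 4000000 in
/-- **Finite core, slice: value #1 in `[0, 10913)`** (32 452 live prefixes; one Bool walker term, `decide` in the kernel). [folklore] -/
theorem stampWalk_fiftysix_four_s1_0_10913 :
    (@Nat.rec (fun _ => ℕ → Bool) (fun _ => true) (fun (_ : ℕ) (ih : ℕ → Bool) (a : ℕ) => cond (Nat.beq (Nat.mod (Nat.div (@Nat.rec (fun _ => ℕ) ((fun (E : ℕ) => @List.rec ℕ (fun _ => ℕ) 0 (fun (x : ℕ) (_ : List ℕ) (acc : ℕ) => Nat.lor acc (Nat.shiftLeft E x)) [0, 1]) 1) (fun (_ acc : ℕ) => (fun (E : ℕ) => @List.rec ℕ (fun _ => ℕ) 0 (fun (x : ℕ) (_ : List ℕ) (acc : ℕ) => Nat.lor acc (Nat.shiftLeft E x)) [0, 1]) acc) 55) (Nat.pow 2 (a - 1))) 2) 1) (((@Nat.rec (fun _ => ℕ → Bool) (fun _ => true) (fun (_ :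 ℕ) (ih : ℕ → Bool) (b : ℕ) => cond (Nat.beq (Nat.mod (Nat.div (@Nat.rec (fun _ => ℕ) ((fun (E : ℕ) => @List.rec ℕ (fun _ => ℕ) 0 (fun (x : ℕ) (_ : List ℕ) (acc : ℕ) => Nat.lor acc (Nat.shiftLeft E x)) [0, 1, a]) 1) (fun (_ acc : ℕ) => (fun (E : ℕ) => @List.rec ℕ (fun _ => ℕ) 0 (fun (x : ℕ) (_ : List ℕ) (acc : ℕ) => Nat.lor acc (Nat.shiftLeft E x)) [0, 1, a]) acc) 55) (Nat.pow 2 (b - 1))) 2) 1) ((!(Nat.beq (Nat.mod (@Nat.rec (fun _ => ℕ) 1 (fun (k acc : ℕ) => Nat.lor (@Nat.rec (fun _ => ℕ) ((fun (E : ℕ) => @List.rec ℕ (fun _ => ℕ) 0 (fun (x : ℕ) (_ : List ℕ) (acc : ℕ) => Nat.lor acc (Nat.shiftLeft E x)) [0, 1, a]) 1) (fun (_ acc : ℕ) => (fun (E : ℕ) => @List.rec ℕ (fun _ => ℕ) 0 (fun (x : ℕ) (_ : List ℕ) (acc : ℕ) => Nat.lor acc (Nat.shiftLeft E x)) [0,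 1, a]) acc) k) (Nat.shiftLeft acc b)) 56) (2 ^ 10912)) (2 ^ 10912 - 1))) && ih (b + 1)) true) (10913 - (a + 1)) (a + 1))) && ih (a + 1)) true) ((10913 - ((2) + (0 - (2))))) (((2) + (0 - (2))))) = true := by
  decide +kernel

set_option maxHeartbeats 4000000 in
set_option maxRecDepth 100000 in
/-- **`ν(56,4) ≤ 10910`** — `StampLawAt 56 4 10910`: every full-positive-rooted symmetric `56 × 56` half-pencil determinant with `4` terms has
degree `≤ 10910` (T3 ⇒ every `r ≤ deg` is an `56`-fold sum of exponents; values `0, 1` forced; capped at `10912`, padded, sorted; capped multisets;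
the kernel walker slices, peeled level by level with `walk_true`). [folklore] -/
theorem stampLawAt_fiftysix_four : StampLawAt 56 4 10910 := by
  intro d S hS hfull
  by_contra hdeg'
  have hdeg : 10910 < (pencil d S).det.natDegree := not_le.mp hdeg'
  have hq : (pencil d S).det ≠ 0 := by
    intro h0
    rw [h0] at hdeg
    simp at hdeg
  have hmem : ∀ r, r ≤ (pencil d S).det.natDegree → r ∈ (Finset.univ : Finset (Sym (Fin 4) 56)).image
      (fun s : Sym (Fin 4) 56 => ((s : Multiset (Fin 4)).map d).sum) :=
    fun r hr => mem_sumset_of_fullPos d S hq hfull hr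
  set cv : Fin 4 → ℕ := fun i => min (d i) 10912 with hcv
  have hcvle : ∀ i, cv i ≤ 10912 := fun i => Nat.min_le_right _ _
  set V : Finset ℕ := Finset.univ.image cv with hV
  have hcvV : ∀ i, cv i ∈ V := fun i => Finset.mem_image_of_mem cv (Finset.mem_univ i)
  have h0V : 0 ∈ V := by
    obtain ⟨i, hi⟩ := exists_index_eq_zero d 10912 (by norm_num) (by norm_num) (hmem 0 (by omega))
    exact hi ▸ hcvV i
  have h1V : 1 ∈ V := by
    obtain ⟨i, hi⟩ := exists_index_eq_one d 10912 (by norm_num) (hmem 1 (by omega))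
    exact hi ▸ hcvV i
  have h1V' : 1 ∈ V.erase 0 := Finset.mem_erase.mpr ⟨by norm_num, h1V⟩
  set W : Finset ℕ := (V.erase 0).erase 1 with hW
  have hWsub : W ⊆ ((Finset.range 10913).erase 0).erase 1 := by
    intro u hu
    rw [hW, Finset.mem_erase, Finset.mem_erase] at hu
    obtain ⟨hu1, hu0, huV⟩ := hu
    rw [hV, Finset.mem_image] at huV
    obtain ⟨i, -, rfl⟩ := huV
    rw [Finset.mem_erase, Finset.mem_erase, Finset.mem_range]
    exact ⟨hu1, hu0, Nat.lt_succ_of_le (hcvle i)⟩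
  have hWcard : W.card ≤ 2 := by
    have hVK : V.card ≤ 4 := by
      have := Finset.card_image_le (s := (Finset.univ : Finset (Fin 4))) (f := cv)
      simpa using this
    have h1 : (V.erase 0).card + 1 = V.card := Finset.card_erase_add_one h0V
    have h2 : W.card + 1 = (V.erase 0).card := by rw [hW]; exact Finset.card_erase_add_one h1V'
    omega
  obtain ⟨W', hWW', hW'sub, hW'card⟩ := Finset.exists_subsuperset_card_eq hWsub hWcard (by
    rw [Finset.card_erase_of_mem (by simp), Finset.card_erase_of_mem (by simp), Finset.card_range]; omega)
  have hVW' : ∀ u ∈ V, u = 0 ∨ u = 1 ∨ u ∈ W' := by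
    intro u hu
    by_cases hu0 : u = 0
    · exact Or.inl hu0
    by_cases hu1 : u = 1
    · exact Or.inr (Or.inl hu1)
    · exact Or.inr (Or.inr (hWW' (by rw [hW, Finset.mem_erase, Finset.mem_erase]; exact ⟨hu1, hu0, hu⟩)))
  have hlmem : ∀ u, u ∈ Finset.sort W' ↔ u ∈ W' := fun u => Finset.mem_sort _
  have hlsort : (Finset.sort W').SortedLT := Finset.sortedLT_sort W'
  have hllen : (Finset.sort W').length = 2 := by rw [Finset.length_sort, hW'card]
  generalize hl : Finset.sort W' = l at hlmem hlsort hllen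
  rcases l with _ | ⟨a, _ | ⟨b, _ | ⟨zz, ll⟩⟩⟩
  all_goals simp only [List.length_cons, List.length_nil] at hllen
  all_goals try omega
  have hltC : ∀ u, u ∈ [a, b] → u < 10913 := by
    intro u hu
    have hu' : u ∈ W' := (hlmem u).mp hu
    have := hW'sub hu'
    rw [Finset.mem_erase, Finset.mem_erase, Finset.mem_range] at this
    exact this.2.2
  have hgt : ∀ u, u ∈ [a, b] → 1 < u := by
    intro u hu
    have hu' : u ∈ W' := (hlmem u).mp hu
    have := hW'sub hu'
    rw [Finset.mem_erase, Finset.mem_erase] at this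
    omega
  have hlt0 : 1 < a := hgt a (by simp)
  have hin : ∀ u ∈ V, u ∈ [0, 1, a, b] := by
    intro u hu
    rcases hVW' u hu with h | h | h
    · rw [h]; simp
    · rw [h]; simp
    · exact List.mem_cons_of_mem _ (List.mem_cons_of_mem _ ((hlmem u).mpr h))
  have hL : ∀ i, min (d i) 10912 ∈ [0, 1, a, b] := fun i => by
    have := hin _ (hcvV i)
    simpa only [hcv] using this
  have hcovP : ∀ r, r ≤ 10911 → ∃ t : Multiset ℕ, (∀ x ∈ t, x ∈ [0, 1, a, b]) ∧ Multiset.card t = 56 ∧ t.sum = r := by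
    intro r hr
    have hr' := hmem r (le_trans hr hdeg)
    have key := exists_multiset_of_mem_sumset d 10912 [0, 1, a, b] hL (Nat.lt_succ_of_le hr) hr'
    exact key
  have hlt1 : a < b := by
    have := hlsort (show (⟨0, by simp⟩ : Fin [a, b].length) < ⟨1, by simp⟩ from Fin.mk_lt_mk.mpr (by norm_num))
    simpa using this
  have hC0 : a < 10913 := hltC a (by simp)
  have hC1 : b < 10913 := hltC b (by simp)
  have hrest0 : ∀ y ∈ [a, b], a ≤ y := by
    intro y hy
    simp only [List.mem_cons, List.mem_nil_iff, or_false] at hy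
    omega
  have hcov0 : ∀ r < min 10912 a, ((@Nat.rec (fun _ => ℕ) ((fun (E : ℕ) => @List.rec ℕ (fun _ => ℕ) 0 (fun (x : ℕ) (_ : List ℕ) (acc : ℕ) => Nat.lor acc (Nat.shiftLeft E x)) [0, 1]) 1) (fun (_ acc : ℕ) => (fun (E : ℕ) => @List.rec ℕ (fun _ => ℕ) 0 (fun (x : ℕ) (_ : List ℕ) (acc : ℕ) => Nat.lor acc (Nat.shiftLeft E x)) [0, 1]) acc) 55)).testBit r = true := by
    intro r hr
    obtain ⟨t, ht, hcard, hsum⟩ := hcovP r (by omega)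
    have ht' := multiset_prefix (l₁ := [0, 1]) (l₂ := [a, b]) hrest0 (by omega) ht
    rw [← hsum]
    exact testBit_lagMask_of_multiset [0, 1] 55 t ht' hcard
  have hg0 := cover_guards (Mp := (@Nat.rec (fun _ => ℕ) ((fun (E : ℕ) => @List.rec ℕ (fun _ => ℕ) 0 (fun (x : ℕ) (_ : List ℕ) (acc : ℕ) => Nat.lor acc (Nat.shiftLeft E x)) [0, 1]) 1) (fun (_ acc : ℕ) => (fun (E : ℕ) => @List.rec ℕ (fun _ => ℕ) 0 (fun (x : ℕ) (_ : List ℕ) (acc : ℕ) => Nat.lor acc (Nat.shiftLeft E x)) [0, 1]) acc) 55)) (lo := 1) (hltC a (by simp)) (le_refl 10913) hcov0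
  have hrest1 : ∀ y ∈ [b], b ≤ y := by
    intro y hy
    simp only [List.mem_cons, List.mem_nil_iff, or_false] at hy
    omega
  have hcov1 : ∀ r < min 10912 b, ((@Nat.rec (fun _ => ℕ) ((fun (E : ℕ) => @List.rec ℕ (fun _ => ℕ) 0 (fun (x : ℕ) (_ : List ℕ) (acc : ℕ) => Nat.lor acc (Nat.shiftLeft E x)) [0, 1, a]) 1) (fun (_ acc : ℕ) => (fun (E : ℕ) => @List.rec ℕ (fun _ => ℕ) 0 (fun (x : ℕ) (_ : List ℕ) (acc : ℕ) => Nat.lor acc (Nat.shiftLeft E x)) [0, 1, a]) acc) 55)).testBit r = true := by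
    intro r hr
    obtain ⟨t, ht, hcard, hsum⟩ := hcovP r (by omega)
    have ht' := multiset_prefix (l₁ := [0, 1, a]) (l₂ := [b]) hrest1 (by omega) ht
    rw [← hsum]
    exact testBit_lagMask_of_multiset [0, 1, a] 55 t ht' hcard
  have hg1 := cover_guards (Mp := (@Nat.rec (fun _ => ℕ) ((fun (E : ℕ) => @List.rec ℕ (fun _ => ℕ) 0 (fun (x : ℕ) (_ : List ℕ) (acc : ℕ) => Nat.lor acc (Nat.shiftLeft E x)) [0, 1, a]) 1) (fun (_ acc : ℕ) => (fun (E : ℕ) => @List.rec ℕ (fun _ => ℕ) 0 (fun (x : ℕ) (_ : List ℕ) (acc : ℕ) => Nat.lor acc (Nat.shiftLeft E x)) [0, 1, a]) acc) 55)) (lo := a) (hltC b (by simp)) (le_refl 10913) hcov1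
  have hleaf : Nat.beq (Nat.mod (@Nat.rec (fun _ => ℕ) 1 (fun (k acc : ℕ) => Nat.lor (@Nat.rec (fun _ => ℕ) ((fun (E : ℕ) => @List.rec ℕ (fun _ => ℕ) 0 (fun (x : ℕ) (_ : List ℕ) (acc : ℕ) => Nat.lor acc (Nat.shiftLeft E x)) [0, 1, a]) 1) (fun (_ acc : ℕ) => (fun (E : ℕ) => @List.rec ℕ (fun _ => ℕ) 0 (fun (x : ℕ) (_ : List ℕ) (acc : ℕ) => Nat.lor acc (Nat.shiftLeft E x)) [0, 1, a]) acc) k) (Nat.shiftLeft acc b)) 56) (2 ^ 10912)) (2 ^ 10912 - 1) = true := by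
    apply rawCover_of_testBit (t := 10912)
    intro r hr
    obtain ⟨t, ht, hcard, hsum⟩ := hcovP r (by omega)
    rw [← hsum]
    exact testBit_incMask2_of_multiset [0, 1, a] b 56 t ht hcard
  have peel : ∀ (Z LO HI : ℕ), Z = 2 → LO ≤ a → a < HI →
      (@Nat.rec (fun _ => ℕ → Bool) (fun _ => true) (fun (_ : ℕ) (ih : ℕ → Bool) (a : ℕ) => cond (Nat.beq (Nat.mod (Nat.div (@Nat.rec (fun _ => ℕ) ((fun (E : ℕ) => @List.rec ℕ (fun _ => ℕ) 0 (fun (x : ℕ) (_ : List ℕ) (acc : ℕ) => Nat.lor acc (Nat.shiftLeft E x)) [0, 1]) 1) (fun (_ acc : ℕ) => (fun (E : ℕ) => @List.rec ℕ (fun _ => ℕ) 0 (fun (x : ℕ) (_ : List ℕ) (acc : ℕ) => Nat.lor acc (Nat.shiftLeft E x)) [0, 1]) acc) 55) (Nat.pow 2 (a - 1))) 2) 1) (((@Nat.rec (fun _ => ℕ → Bool) (fun _ => true) (fun (_ : ℕ) (ih : ℕ → Bool) (b : ℕ) => cond (Nat.beq (Nat.mod (Nat.div (@Nat.rec (fun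 _ => ℕ) ((fun (E : ℕ) => @List.rec ℕ (fun _ => ℕ) 0 (fun (x : ℕ) (_ : List ℕ) (acc : ℕ) => Nat.lor acc (Nat.shiftLeft E x)) [0, 1, a]) 1) (fun (_ acc : ℕ) => (fun (E : ℕ) => @List.rec ℕ (fun _ => ℕ) 0 (fun (x : ℕ) (_ : List ℕ) (acc : ℕ) => Nat.lor acc (Nat.shiftLeft E x)) [0, 1, a]) acc) 55) (Nat.pow 2 (b - 1))) 2) 1) ((!(Nat.beq (Nat.mod (@Nat.rec (fun _ => ℕ) 1 (fun (k acc : ℕ) => Nat.lor (@Nat.rec (fun _ => ℕ) ((fun (E : ℕ) => @List.rec ℕ (fun _ => ℕ) 0 (fun (x : ℕ) (_ : List ℕ) (acc : ℕ) => Nat.lor acc (Nat.shiftLeft E x)) [0, 1, a]) 1) (fun (_ acc : ℕ) => (fun (E : ℕ) => @List.rec ℕ (fun _ => ℕ) 0 (fun (x : ℕ) (_ : List ℕ) (acc : ℕ) => Nat.lor acc (Nat.shiftLeft E x)) [0, 1, a]) acc) k) (Nat.shiftLeft acc b)) 56) (2 ^ 10912)) (2 ^ 10912 - 1))) && ih (b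 + 1)) true) (10913 - (a + 1)) (a + 1))) && ih (a + 1)) true) ((HI - ((Z) + (LO - (Z))))) (((Z) + (LO - (Z))))) = true → False := by
    intro Z LO HI hZ hLO hHI W0
    have W1 := walk_true (p := fun (a : ℕ) => Nat.beq (Nat.mod (Nat.div (@Nat.rec (fun _ => ℕ) ((fun (E : ℕ) => @List.rec ℕ (fun _ => ℕ) 0 (fun (x : ℕ) (_ : List ℕ) (acc : ℕ) => Nat.lor acc (Nat.shiftLeft E x)) [0, 1]) 1) (fun (_ acc : ℕ) => (fun (E : ℕ) => @List.rec ℕ (fun _ => ℕ) 0 (fun (x : ℕ) (_ : List ℕ) (acc : ℕ) => Nat.lor acc (Nat.shiftLeft E x)) [0, 1]) acc) 55) (Nat.pow 2 (a - 1))) 2) 1) (q := fun (a : ℕ) => (@Nat.rec (fun _ => ℕ → Bool) (fun _ => true) (fun (_ : ℕ) (ih : ℕ → Bool) (b : ℕ) => cond (Nat.beq (Nat.mod (Nat.div (@Nat.rec (fun _ => ℕ) ((fun (E : ℕ) => @List.rec ℕ (fun _ => ℕ) 0 (fun (x : ℕ) (_ : List ℕ) (acc : ℕ) => Nat.lor acc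 (Nat.shiftLeft E x)) [0, 1, a]) 1) (fun (_ acc : ℕ) => (fun (E : ℕ) => @List.rec ℕ (fun _ => ℕ) 0 (fun (x : ℕ) (_ : List ℕ) (acc : ℕ) => Nat.lor acc (Nat.shiftLeft E x)) [0, 1, a]) acc) 55) (Nat.pow 2 (b - 1))) 2) 1) ((!(Nat.beq (Nat.mod (@Nat.rec (fun _ => ℕ) 1 (fun (k acc : ℕ) => Nat.lor (@Nat.rec (fun _ => ℕ) ((fun (E : ℕ) => @List.rec ℕ (fun _ => ℕ) 0 (fun (x : ℕ) (_ : List ℕ) (acc : ℕ) => Nat.lor acc (Nat.shiftLeft E x)) [0, 1, a]) 1) (fun (_ acc : ℕ) => (fun (E : ℕ) => @List.rec ℕ (fun _ => ℕ) 0 (fun (x : ℕ) (_ : List ℕ) (acc : ℕ) => Nat.lor acc (Nat.shiftLeft E x)) [0, 1, a]) acc) k) (Nat.shiftLeft acc b)) 56) (2 ^ 10912)) (2 ^ 10912 - 1))) && ih (b + 1)) true) (10913 - (a + 1)) (a + 1))) ((HI - ((Z) + (LO - (Z))))) (((Z) + (LO - (Z)))) a (by omega) (by omega) (fun c' h1 h2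 => hg0 c' (by omega) h2) W0
    have W2 := walk_true (p := fun (b : ℕ) => Nat.beq (Nat.mod (Nat.div (@Nat.rec (fun _ => ℕ) ((fun (E : ℕ) => @List.rec ℕ (fun _ => ℕ) 0 (fun (x : ℕ) (_ : List ℕ) (acc : ℕ) => Nat.lor acc (Nat.shiftLeft E x)) [0, 1, a]) 1) (fun (_ acc : ℕ) => (fun (E : ℕ) => @List.rec ℕ (fun _ => ℕ) 0 (fun (x : ℕ) (_ : List ℕ) (acc : ℕ) => Nat.lor acc (Nat.shiftLeft E x)) [0, 1, a]) acc) 55) (Nat.pow 2 (b - 1))) 2) 1) (q := fun (b : ℕ) => !(Nat.beq (Nat.mod (@Nat.rec (fun _ => ℕ) 1 (fun (k acc : ℕ) => Nat.lor (@Nat.rec (fun _ => ℕ) ((fun (E : ℕ) => @List.rec ℕ (fun _ => ℕ) 0 (fun (x : ℕ) (_ : List ℕ) (acc : ℕ) => Nat.lor acc (Nat.shiftLeft E x)) [0, 1, a]) 1) (fun (_ acc : ℕ) => (fun (E : ℕ) => @List.rec ℕ (fun _ => ℕ) 0 (fun (x : ℕ) (_ : List ℕ) (acc : ℕ) => Nat.lor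 acc (Nat.shiftLeft E x)) [0, 1, a]) acc) k) (Nat.shiftLeft acc b)) 56) (2 ^ 10912)) (2 ^ 10912 - 1))) (10913 - (a + 1)) (a + 1) b (by omega) (by omega) (fun c' h1 h2 => hg1 c' (by omega) h2) W1
    have WL : (!(Nat.beq (Nat.mod (@Nat.rec (fun _ => ℕ) 1 (fun (k acc : ℕ) => Nat.lor (@Nat.rec (fun _ => ℕ) ((fun (E : ℕ) => @List.rec ℕ (fun _ => ℕ) 0 (fun (x : ℕ) (_ : List ℕ) (acc : ℕ) => Nat.lor acc (Nat.shiftLeft E x)) [0, 1, a]) 1) (fun (_ acc : ℕ) => (fun (E : ℕ) => @List.rec ℕ (fun _ => ℕ) 0 (fun (x : ℕ) (_ : List ℕ) (acc : ℕ) => Nat.lor acc (Nat.shiftLeft E x)) [0, 1, a]) acc) k) (Nat.shiftLeft acc b)) 56) (2 ^ 10912)) (2 ^ 10912 - 1))) = true := W2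
    rw [hleaf] at WL
    exact Bool.false_ne_true WL
  exact peel 2 0 10913 rfl (Nat.zero_le _) (hltC a (by simp)) stampWalk_fiftysix_four_s1_0_10913

end Summit.ValiantsHypothesis.ValiantsHypothesis.Theorems.LacunarySymmetroidMatrixDescartes.FiniteSector
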